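/-
Width seat `ym-line-cbag-p1-w3` (prover-ym-line-cbag-p1-w3-g8-0; own items stmt-QuantumFields-22254 / 22893 CLOSED proved), the only seat
left on LINE 3 `route-QuantumFields-SixPlaneColdBox`: the two route-posited OBJECTS of the registered birth skeleton of crux
`DensityTransferG` (stmt-QuantumFields-25709), verbatim, so that its registered stubs can be landed BY NAME from an importable module.
-/
import Summits.QuantumFields.YangMills.Theses.SixPlaneColdBox

/-!
# `DensityTransferG` (crux stmt-QuantumFields-25709, route `SixPlaneColdBox`): the objects of the birth skeleton

Route `SixPlaneColdBox` is LINE 3 of the ideator cell ym-idea-2 — a line onto the RECORD-type node `Theorems.LatticeNonFreezing`, NOT a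
rung of `YangMills`.  Its crux `Theses.SixPlaneColdBox.DensityTransferG : TorusMeanNearColdBoxG → BulkDominatesBoxDensityG` carries the
registered birth skeleton `bc/DensityTransferG_birth.lean` (planner ym-idea-2 g2, sha `248f43f0f52c`): the crux is the composition
`DensityTransferG_of (h₁ : SixPlaneTransferWithSlackG) (h₂ : SlackAbsorptionG) := fun hT => h₂ (h₁ hT)` of

* `SixPlaneTransferWithSlackG` — GIVEN the torus-mean bound, the one-sided DLR transfer of the β²-scaled six-plane cold-box covariance to
  the torus up to the additive slack `β^{−(8A+m)}` (stub 1; its content is `sixPlaneTransferWithSlack_of_torusMeanNear`,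
  `Theorems/SixPlaneColdBoxTransferWithSlack.lean`);
* `SlackAbsorptionG` — the landed positive cold-box floor absorbs the slack into `η/2` (stub 2; its content is w2's
  `bulkDominatesBoxDensityG_of_slack`, `Theorems/SixPlaneColdBoxSlackAbsorption.lean`).

This file states the two `Prop`s VERBATIM from the skeleton (namespace `…Theorems.SixPlaneColdBox` instead of the skeleton's
`…Cruxes.DensityTransferG.Birth`) and records the composition `densityTransferG_of`.  Definitions only; no sorry; standard axioms.
Nothing here bears on the Yang–Mills mass gap.
-/

set_option autoImplicit false

noncomputable section

open MeasureTheory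
open Literature.MathematicalPhysics.QuantumLattice
open Literature.MathematicalPhysics.QuantumFieldTheory
open Literature.MathematicalPhysics.QuantumFieldTheory.LatticeMaxwell
open Summit.QuantumFields.YangMills.Theorems.WeakCouplingRates
open Summit.QuantumFields.YangMills.Theorems.FreeEnergyLogCoefficient
open Summit.QuantumFields.YangMills.Theses.SixPlaneColdBox (TorusMeanNearColdBoxG BulkDominatesBoxDensityG DensityTransferG)

namespace Summit.QuantumFields.YangMills.Theorems.SixPlaneColdBox

/-- **Stub 1 of the birth skeleton of `DensityTransferG` (verbatim).**  The analytic content WITH SLACK: given the torus-mean bound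
`TorusMeanNearColdBoxG`, for every compact simple `G` and lattice representation `r` there are exponents `0 < A < θ ≤ 1/100`, `η > 0`,
`m > 0` with, for all large `β` and then all large odd tori,
`η·β²·Cov_{box ⌈β^θ⌉}(F_c, F_{c+⌈β^A⌉e₀}) − β^{−(8A+m)} ≤ β²·⟨actionDensity ; actionDensity⟩_{torus, ⌈β^A⌉}` for the six-plane cost sums `F`. -/
def SixPlaneTransferWithSlackG : Prop :=
  TorusMeanNearColdBoxG →
  ∀ (G : Type) [Group G] [TopologicalSpace G] [IsTopologicalGroup G] [CompactSpace G],
    IsCompactSimpleLieGroup G →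
      letI : MeasurableSpace G := borel G
      haveI : BorelSpace G := ⟨rfl⟩
      ∀ r : LatticeRep G, ∃ A θ η m : ℝ, 0 < A ∧ A < θ ∧ θ ≤ 1 / 100 ∧ 0 < η ∧ 0 < m ∧
        ∃ β₀ : ℝ, ∀ β : ℝ, β₀ ≤ β → ∃ S₀ : ℕ, ∀ S : ℕ, S₀ ≤ S →
          η * (β ^ 2 *
              ((∫ U, (∑ q : {q : Fin 4 × Fin 4 // q.1 < q.2}, plaqCostAt r.ρ (boxCentre ⌈β ^ θ⌉₊) q.1.1 q.1.2 U) *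
                    (∑ q : {q : Fin 4 × Fin 4 // q.1 < q.2},
                      plaqCostAt r.ρ (boxCentre ⌈β ^ θ⌉₊ + Pi.single 0 (⌈β ^ A⌉₊ : ℤ)) q.1.1 q.1.2 U) ∂(boxState r.ρ β ⌈β ^ θ⌉₊)) -
                (∫ U, (∑ q : {q : Fin 4 × Fin 4 // q.1 < q.2}, plaqCostAt r.ρ (boxCentre ⌈β ^ θ⌉₊) q.1.1 q.1.2 U) ∂(boxState r.ρ β ⌈β ^ θ⌉₊)) *
                  (∫ U, (∑ q : {q : Fin 4 × Fin 4 // q.1 < q.2},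
                      plaqCostAt r.ρ (boxCentre ⌈β ^ θ⌉₊ + Pi.single 0 (⌈β ^ A⌉₊ : ℤ)) q.1.1 q.1.2 U) ∂(boxState r.ρ β ⌈β ^ θ⌉₊)))) -
              β ^ (-(8 * A + m)) ≤
            β ^ 2 * latticeConnectedCorr r.ρ β (2 * S + 1) (actionDensity r.ρ) (actionDensity r.ρ) ⌈β ^ A⌉₊

/-- **Stub 2 of the birth skeleton of `DensityTransferG` (verbatim).**  Slack absorption: the transfer with slack (the consequent of
`SixPlaneTransferWithSlackG`, spelled out) implies the target `BulkDominatesBoxDensityG` — the landed positive cold-box floor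
`boxActionDensityFloor_allGroups` absorbs the additive error `β^{−(8A+m)}` into `η/2`. -/
def SlackAbsorptionG : Prop :=
  (∀ (G : Type) [Group G] [TopologicalSpace G] [IsTopologicalGroup G] [CompactSpace G],
    IsCompactSimpleLieGroup G →
      letI : MeasurableSpace G := borel G
      haveI : BorelSpace G := ⟨rfl⟩
      ∀ r : LatticeRep G, ∃ A θ η m : ℝ, 0 < A ∧ A < θ ∧ θ ≤ 1 / 100 ∧ 0 < η ∧ 0 < m ∧
        ∃ β₀ : ℝ, ∀ β : ℝ, β₀ ≤ β → ∃ S₀ : ℕ, ∀ S : ℕ, S₀ ≤ S →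
          η * (β ^ 2 *
              ((∫ U, (∑ q : {q : Fin 4 × Fin 4 // q.1 < q.2}, plaqCostAt r.ρ (boxCentre ⌈β ^ θ⌉₊) q.1.1 q.1.2 U) *
                    (∑ q : {q : Fin 4 × Fin 4 // q.1 < q.2},
                      plaqCostAt r.ρ (boxCentre ⌈β ^ θ⌉₊ + Pi.single 0 (⌈β ^ A⌉₊ : ℤ)) q.1.1 q.1.2 U) ∂(boxState r.ρ β ⌈β ^ θ⌉₊)) -
                (∫ U, (∑ q : {q : Fin 4 × Fin 4 // q.1 < q.2}, plaqCostAt r.ρ (boxCentre ⌈β ^ θ⌉₊) q.1.1 q.1.2 U) ∂(boxState r.ρ β ⌈β ^ θ⌉₊)) *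
                  (∫ U, (∑ q : {q : Fin 4 × Fin 4 // q.1 < q.2},
                      plaqCostAt r.ρ (boxCentre ⌈β ^ θ⌉₊ + Pi.single 0 (⌈β ^ A⌉₊ : ℤ)) q.1.1 q.1.2 U) ∂(boxState r.ρ β ⌈β ^ θ⌉₊)))) -
              β ^ (-(8 * A + m)) ≤
            β ^ 2 * latticeConnectedCorr r.ρ β (2 * S + 1) (actionDensity r.ρ) (actionDensity r.ρ) ⌈β ^ A⌉₊) →
    BulkDominatesBoxDensityG

/-- The skeleton's composition (BC3): the two stubs give the crux `DensityTransferG` by name. -/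
theorem densityTransferG_of (h₁ : SixPlaneTransferWithSlackG) (h₂ : SlackAbsorptionG) : DensityTransferG :=
  fun hT => h₂ (h₁ hT)

end Summit.QuantumFields.YangMills.Theorems.SixPlaneColdBox

end
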